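import Mathlib
import HarnessLib
import Literature.MathematicalPhysics.QuantumLattice.HubbardInteractionKernels
import Summits.HubbardSuperconductivity.HubbardSuperconductivity.Theorems.KLProgrammeKLRegimeSplitTwoLegMomentsOffDiag
import Summits.HubbardSuperconductivity.HubbardSuperconductivity.Theorems.KLProgrammeKLRegimeSplitTwoLegIncrementMomentsFromPosition

/-!
# Route `KLProgramme` — ENGINE child 19918, two-leg slot at scale `0`: the self-energy of the counterterm vertex IS the frame,
# `Σ_{𝒩_K}((ω,k⃗),σ) = K(p_k⃗)`, so the K-separated data is the localised two-leg data of `𝒱^{(n)} − 𝒩_K`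

Cell `gate-hubbard-kl`, seat p1b (g7).  Completes the interface of `SCALE0-TWOLEG-EXPORTS.md` (evidence on 19918): the decomposition
hypothesis `klLocSelfEnergyRe … K 0 − K∘p = loc(G')` of `twoLeg_scaleZero_sep_moments_of_decomposition` (`…TwoLegMomentsOffDiag`) is discharged
with the CONCRETE element `G' := klEffectiveAction … K klE0 n − counterQuadratic L M β K` (`effAction`'s tree level is `+(V + 𝒩_K)`,
`GrassmannEffectiveAction.effAction`; so `G'`'s two-leg part is the tadpole plus the cumulants of order `≥ 2`):

* `kernel_counterQuadratic_two_string` — `kernel (𝒩_K) 2 ((k,σ,+),(k,σ,−)) = K(p_k⃗)/(βL²)·(2!)⁻¹` (the delta determinant of two leg strings);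
* **`selfEnergy_counterQuadratic`** — `selfEnergy L M β (counterQuadratic L M β K) (ω,k⃗) σ = K(p_k⃗)` (`β ≠ 0`);
* **`klLocSelfEnergyRe_sub_frame_eq_locRe`** — at every scale `n`:
  `klLocSelfEnergyRe … K n k⃗ − K(p_k⃗) = ¼Σ_σ[Re Σ_{G'}((ω₀,k⃗),σ) + Re Σ_{G'}((−ω₀,k⃗),σ)]`, `G' = klEffectiveAction … K klE0 n − counterQuadratic L M β K`;
* **`twoLeg_scaleZero_sep_moments_of_counterSeparated`** — hence the sizes `m₀ = 2Mˢ₀(G')`, `mₖ = 2Mˢ♯ₖ(G')` (`k = 1,2`) of the K-separated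
  scale-`0` tier-1 closer (`twoLegPieceFn_eval_zero_tier1_size_le_sep[_of_degree_le]`) from the full zeroth / OFF-DIAGONAL first and second
  pinned position moments of the unsectorised two-leg kernels of `𝒱^{(0)} − 𝒩_K` — the ENGINE's remaining scale-0 (E3a) export.

Proofs only; no definitions; nothing about the model is asserted.  References: BGM 2003 (2.10), BGM 2006 §2.1 (2.6), §2.3 [cite: BenfattoGiulianiMastropietro2006].
-/

noncomputable section

namespace Summit.HubbardSuperconductivity.HubbardSuperconductivity.Theorems.TwoLegFourier

set_option linter.dupNamespace false -- summit = problem name (single-conjunct summit), D-0017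

open Finset Complex
open Literature.MathematicalPhysics.QuantumLattice Literature.Probability.LatticeModels GrassmannAlgebra
open Summit.HubbardSuperconductivity.HubbardSuperconductivity.Theorems.KLRegimeSplit
open Summit.HubbardSuperconductivity.HubbardSuperconductivity.Theorems.KLProgrammeLegKernels

variable {L M : ℕ} [NeZero L]

/-! ## §1 The two-leg kernel and the self-energy of the counterterm vertex -/

omit [NeZero L] in
/-- The delta determinant of two `(+,−)` leg strings at `(k,σ)` and `(k',σ')`: `[(k',σ') = (k,σ)]`. -/
theorem det_deltaMatrix_twoString (k k' : FreqMomentum L M) (σ σ' : Fin 2) :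
    (deltaMatrix ℂ (![((k, σ), 0), ((k, σ), 1)] : Fin 2 → HubbardFieldIdx L M)
      (![((k', σ'), 0), ((k', σ'), 1)] : Fin 2 → HubbardFieldIdx L M)).det =
      if (k', σ') = (k, σ) then 1 else 0 := by
  rw [Matrix.det_fin_two]
  simp only [deltaMatrix_apply, Matrix.cons_val_zero, Matrix.cons_val_one, Prod.mk.injEq]
  by_cases h : k = k' ∧ σ = σ'
  · obtain ⟨rfl, rfl⟩ := h
    simp
  · have h2 : ¬(k' = k ∧ σ' = σ) := fun hh => h ⟨hh.1.symm, hh.2.symm⟩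
    simp [h, h2]

/-- **The two-leg kernel of the counterterm vertex at a `(+,−)` string**: `kernel 𝒩_K 2 ((k,σ,+),(k,σ,−)) = (2!)⁻¹ · K(p_k⃗)/(βL²)`. -/
theorem kernel_counterQuadratic_two_string (β : ℝ) (K : TrigPolyC4v) (k : FreqMomentum L M) (σ : Fin 2) :
    kernel ℂ (counterQuadratic L M β K) 2 (![((k, σ), 0), ((k, σ), 1)] : Fin 2 → HubbardFieldIdx L M) =
      ((K.eval (latticeMomentum L k.2) / (β * (L : ℝ) ^ 2) : ℝ) : ℂ) * (((2 : ℕ).factorial : ℚ)⁻¹ • (1 : ℂ)) := by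
  rw [counterQuadratic, kernel_sum]
  have hgen : ∀ (k' : FreqMomentum L M) (s : Fin 2),
      psiPlus k' s * psiMinus k' s = genProd ℂ (![((k', s), 0), ((k', s), 1)] : Fin 2 → HubbardFieldIdx L M) := by
    intro k' s
    rw [genProd_succ, genProd_succ, genProd_zero, mul_one]
    rfl
  have hterm : ∀ k' : FreqMomentum L M, kernel ℂ (∑ s : Fin 2,
      ((K.eval (latticeMomentum L k'.2) / (β * (L : ℝ) ^ 2) : ℝ) : ℂ) • (psiPlus k' s * psiMinus k' s)) 2
        (![((k, σ), 0), ((k, σ), 1)] : Fin 2 → HubbardFieldIdx L M) =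
      if k' = k then ((K.eval (latticeMomentum L k.2) / (β * (L : ℝ) ^ 2) : ℝ) : ℂ) * (((2 : ℕ).factorial : ℚ)⁻¹ • (1 : ℂ)) else 0 := by
    intro k'
    rw [kernel_sum]
    simp_rw [kernel_smul, hgen, kernel_genProd, det_deltaMatrix_twoString]
    by_cases hk : k' = k
    · subst hk
      rw [if_pos rfl, Fin.sum_univ_two]
      fin_cases σ <;> simp
    · rw [if_neg hk]
      refine sum_eq_zero fun s _ => ?_
      rw [if_neg (fun h => hk (Prod.mk.inj h).1), mul_zero, mul_zero]
  simp_rw [hterm]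
  rw [sum_ite_eq' univ k, if_pos (mem_univ _)]

/-- **THE SELF-ENERGY OF THE COUNTERTERM VERTEX IS THE FRAME**: `Σ_{𝒩_K}((ω,k⃗),σ) = K(p_k⃗)` (`β ≠ 0`; frequency- and spin-independent, real). -/
theorem selfEnergy_counterQuadratic [NeZero M] {β : ℝ} (hβ : β ≠ 0) (K : TrigPolyC4v) (k : FreqMomentum L M) (σ : Fin 2) :
    selfEnergy L M β (counterQuadratic L M β K) k σ = ((K.eval (latticeMomentum L k.2) : ℝ) : ℂ) := by
  rw [selfEnergy_eq_vertexFn, kernel_counterQuadratic_two_string]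
  have h2 : (((2 : ℕ).factorial : ℚ)⁻¹ • (1 : ℂ)) = ((2 : ℂ))⁻¹ := by
    rw [Rat.smul_one_eq_cast]; norm_num [Nat.factorial]
  rw [h2]
  have hβc : (β : ℂ) ≠ 0 := Complex.ofReal_ne_zero.2 hβ
  have hLc : (L : ℂ) ≠ 0 := Nat.cast_ne_zero.2 (NeZero.ne L)
  push_cast
  field_simp

/-! ## §2 The K-separated localised data is the localised data of `𝒱^{(n)} − 𝒩_K` -/

section Model

variable [NeZero M]

/-- **`klLocSelfEnergyRe … K n − K∘p = loc(𝒱^{(n)} − 𝒩_K)`** at every scale `n` (`β ≠ 0`): the frame vertex contained in the cell's localised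
two-leg data (docstring of `klLocSelfEnergyRe`) is exactly the self-energy of `counterQuadratic L M β K`. -/
theorem klLocSelfEnergyRe_sub_frame_eq_locRe {β : ℝ} (hβ : β ≠ 0) (U μ : ℝ) (K : TrigPolyC4v) (n : ℕ) (k : TorusSite 2 L) :
    klLocSelfEnergyRe L M β U μ K n k - K.eval (latticeMomentum L k) =
      (∑ σ : Fin 2, ((selfEnergy L M β (klEffectiveAction L M β U μ K klE0 n - counterQuadratic L M β K) (omega0 M, k) σ).re +
        (selfEnergy L M β (klEffectiveAction L M β U μ K klE0 n - counterQuadratic L M β K) ((omega0 M).rev, k) σ).re)) / 4 := by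
  simp only [klLocSelfEnergyRe, klSelfEnergy, selfEnergy_sub, Complex.sub_re, selfEnergy_counterQuadratic hβ, Complex.ofReal_re,
    Fin.sum_univ_two]
  ring

/-- **THE ENGINE'S SCALE-0 (E3a) EXPORT, FINAL SHAPE**: with `G' := 𝒱^{(0)} − 𝒩_K`, the full pinned zeroth moment `Mˢ₀` and the OFF-DIAGONAL
pinned first/second moments `Mˢ♯ₖ` of `G'`'s unsectorised two-leg kernels give the sizes of the K-separated tier-1 closer:
`‖Dᵏ evalM (symInterp L (klLocSelfEnergyRe…0 − K∘p)) q‖ ≤ 2·(if k = 0 then Mˢ₀ else Mˢ♯ₖ)`, `k ≤ 2`. -/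
theorem twoLeg_scaleZero_sep_moments_of_counterSeparated {β : ℝ} (hβ : 0 < β) (U μ : ℝ) (K : TrigPolyC4v) {Ms0 : ℝ} {Msh : ℕ → ℝ}
    (hMs0 : ∀ (σ : Fin 2) (x₀ : SpaceTimeIdx L M), imagTimeWeight β M *
      ∑ x ∈ (univ : Finset (Fin 2 → SpaceTimeIdx L M)).filter (fun x => x 0 = x₀),
        (1 + ((((x 1).2 - (x 0).2) 0).valMinAbs.natAbs : ℝ) + ((((x 1).2 - (x 0).2) 1).valMinAbs.natAbs : ℝ)) ^ 0 *
          ‖sectorisedKernel L M β (trivialMultiplier L M)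
              (klEffectiveAction L M β U μ K klE0 0 - counterQuadratic L M β K) 2 (![((0, σ), 0), ((0, σ), 1)] : Fin 2 → SectorLeg 1) x‖ ≤ Ms0)
    (hMsh : ∀ k, 1 ≤ k → k ≤ 2 → ∀ (σ : Fin 2) (x₀ : SpaceTimeIdx L M), imagTimeWeight β M *
      ∑ x ∈ (univ : Finset (Fin 2 → SpaceTimeIdx L M)).filter (fun x => x 0 = x₀ ∧ (x 1).2 ≠ (x 0).2),
        (1 + ((((x 1).2 - (x 0).2) 0).valMinAbs.natAbs : ℝ) + ((((x 1).2 - (x 0).2) 1).valMinAbs.natAbs : ℝ)) ^ k *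
          ‖sectorisedKernel L M β (trivialMultiplier L M)
              (klEffectiveAction L M β U μ K klE0 0 - counterQuadratic L M β K) 2 (![((0, σ), 0), ((0, σ), 1)] : Fin 2 → SectorLeg 1) x‖ ≤ Msh k) :
    ∀ k ≤ 2, ∀ q : Momentum, ‖iteratedFDeriv ℝ k
      (evalM (symInterp L (fun p => klLocSelfEnergyRe L M β U μ K 0 p - K.eval (latticeMomentum L p)))) q‖ ≤
        2 * (if k = 0 then Ms0 else Msh k) :=
  twoLeg_scaleZero_sep_moments_of_decomposition hβ U μ K _ (klLocSelfEnergyRe_sub_frame_eq_locRe hβ.ne' U μ K 0) hMs0 hMsh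

end Model

end Summit.HubbardSuperconductivity.HubbardSuperconductivity.Theorems.TwoLegFourier

end
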